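import Mathlib
import HarnessLib
import Summits.NavierStokesRegularity.NavierStokesRegularity.Theorems.TaylorModelRungThreeCertificateFormatVGrowth2

/-!
# Crux K1b-DR (stmt-NavierStokesRegularity-23954), line `taylor-model` — v3 growth checker: FAST (value-identical) entry points
# (tm-g4 g5)

`GCtx.facOf P w := maxUpTo (fun r => (dget ((|P|·w)↑) r ·↑ (ω⁻¹)↑_r)) n` (tree `…FormatVGrowth`) keeps the row vector `(|P|·w)↑`
INSIDE the lambda handed to `maxUpTo`; compiled Lean does not hoist loop-invariant subterms out of closures (farm probe, this
seat: 580 s vs 0.9 s for the same fold), so every call costs `n·2n²` dyadic operations instead of `2n²`, and `GCtx.step` calls it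
`O(qL + L)` times per sub-step. This module gives VALUE-IDENTICAL fast twins — `GCtx.facOfMag` (row computed once, magnitudes
passed in), `GCtx.stepF` / `GCtx.step2F` (also hoisting `|pre'[0]|` out of the start sweeps), `growthRunF` / `growthRangeF` (v1) and
`growthRun2F` / `growthRange2F` (variant B) — together with the equations `facOfMag_magM`, `stepF_eq`, `step2F_eq` (`rfl`),
`growthRunF_eq`, `growthRangeF_eq`, `growthRun2F_eq`, `growthRange2F_eq`, so every soundness theorem and closer of the landed
checkers applies verbatim to a `true` FAST Boolean (closers in `…CertificateCloserVF`). Nothing landed is touched; no statement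
changes. MODEL-lattice bookkeeping only (rung TL-M3); nothing here is a statement about the Navier–Stokes equations.
-/

-- the sub-problem namespace repeats the summit name by design (D-0017)
set_option linter.dupNamespace false

namespace Summit.NavierStokesRegularity.NavierStokesRegularity.Theorems.TaylorModelCert

namespace GCtx

variable (G : GCtx)

/-- **Growth factor from a MAGNITUDE matrix `A` against a weight vector** — `max_r ((A·w)↑_r · (ω⁻¹)↑_r)` with the row vector
computed ONCE (`facOfMag (magM P) w = facOf P w`). [folklore] -/
def facOfMag (A : Array (Array Dyad)) (w : Array Dyad) : Dyad :=
  let row := absMulVecUp G.n G.prec A w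
  maxUpTo (fun r => Dyad.mulUp G.prec (dget row r) (dget G.ωinvhi r)) G.n

/-- `facOfMag (|P|) w` IS `facOf P w` (definitionally). [folklore] -/
theorem facOfMag_magM (P : Array (Array IntervalD)) (w : Array Dyad) : G.facOfMag (magM G.n P) w = G.facOf P w := rfl

/-- **FAST twin of `GCtx.step`** (same products, same tests; factors via `facOfMag`, `|pre'[0]|` hoisted out of the sweep over the
earlier chunks' starts). [folklore] -/
def stepF (s : ℕ) (M : Array (Array IntervalD)) (coL1 : Dyad) (pre : Array (Array (Array IntervalD))) :
    Array (Array (Array IntervalD)) × Bool :=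
  let pre' := (pre.map fun P => mulII G.n G.prec M P).push M
  let b := s + 1
  let okL1 := Dyad.ble Dyad.zero coL1 && Dyad.ble coL1 (dget G.gL1 s)
  let okIn := allN pre'.size fun i => G.pairTest (G.q * G.L + i) b (G.facOfMag (magM G.n (pre'.getD i #[])) G.ωhi)
  let okDiag := G.pairTest b b (G.facOfMag (magM G.n (idIM G.n)) G.ωhi)
  let mag0 := magM G.n (pre'.getD 0 #[])
  let okOut := allN (G.q * G.L) fun a' => G.pairTest a' b (G.facOfMag mag0 (G.W.getD a' #[]))
  (pre', okL1 && okIn && okDiag && okOut)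

/-- `stepF = step` (definitionally). [folklore] -/
theorem stepF_eq (s : ℕ) (M : Array (Array IntervalD)) (coL1 : Dyad) (pre : Array (Array (Array IntervalD))) :
    G.stepF s M coL1 pre = G.step s M coL1 pre := rfl

/-- **FAST twin of `GCtx.step2`** (variant B; factors via `facOfMag`, `|pre'[0]|` hoisted out of the two start sweeps). [folklore] -/
def step2F (ℓ s : ℕ) (M : Array (Array IntervalD)) (coL1 : Dyad) (st : GState2) : GState2 × Bool :=
  let pre' := (st.pre.map fun P => mulII G.n G.prec M P).push M
  let b := s + 1
  let g := s / ℓ * ℓ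
  let okL1 := Dyad.ble Dyad.zero coL1 && Dyad.ble coL1 (dget G.gL1 s)
  let okIn := allN pre'.size fun i => G.pairTest (g + i) b (G.facOfMag (magM G.n (pre'.getD i #[])) G.ωhi)
  let okDiag := G.pairTest b b (G.facOfMag (magM G.n (idIM G.n)) G.ωhi)
  let mag0 := magM G.n (pre'.getD 0 #[])
  let okMid := allN (g - G.q * G.L) fun i => G.pairTest (G.q * G.L + i) b (G.facOfMag mag0 (st.Uin.getD i #[]))
  let okOut := allN (G.q * G.L) fun a' => G.pairTest a' b (G.facOfMag mag0 (st.Uout.getD a' #[]))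
  ({ st with pre := pre' }, okL1 && okIn && okDiag && okMid && okOut)

/-- `step2F = step2` (definitionally). [folklore] -/
theorem step2F_eq (ℓ s : ℕ) (M : Array (Array IntervalD)) (coL1 : Dyad) (st : GState2) :
    G.step2F ℓ s M coL1 st = G.step2 ℓ s M coL1 st := rfl

end GCtx

namespace CertTablesV

variable (TV : CertTablesV) (kitOf : ℕ → CoreKit) (wT : ℕ → Array Dyad)

/-- **FAST twin of the v1 chunk run `growthRun`** (`stepF` in place of `step`). [folklore] -/
def growthRunF (P : ℕ → CoreOut → Bool) (j : ℕ) (G : GCtx) : ℕ → ℕ → NodeSt → Array (Array (Array IntervalD)) → Bool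
  | 0, s, _, pre => G.claimsOK s pre
  | k + 1, s, N, pre =>
    let o := (TV.ctxOfW kitOf wT j).subStep s N
    let r := G.stepF s o.core.M o.core.L1 pre
    ((o.ok && P s o.core) && r.2) && growthRunF P j G k (s + 1) o.next r.1

/-- `growthRunF = growthRun`. [folklore] -/
theorem growthRunF_eq (P : ℕ → CoreOut → Bool) (j : ℕ) (G : GCtx) :
    ∀ (k s : ℕ) (N : NodeSt) (pre : Array (Array (Array IntervalD))),
      TV.growthRunF kitOf wT P j G k s N pre = TV.growthRun kitOf wT P j G k s N pre
  | 0, _, _, _ => rfl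
  | k + 1, s, N, pre => by
    show (((((TV.ctxOfW kitOf wT j).subStep s N).ok && P s ((TV.ctxOfW kitOf wT j).subStep s N).core) &&
        (G.stepF s ((TV.ctxOfW kitOf wT j).subStep s N).core.M ((TV.ctxOfW kitOf wT j).subStep s N).core.L1 pre).2) &&
        TV.growthRunF kitOf wT P j G k (s + 1) ((TV.ctxOfW kitOf wT j).subStep s N).next
          (G.stepF s ((TV.ctxOfW kitOf wT j).subStep s N).core.M ((TV.ctxOfW kitOf wT j).subStep s N).core.L1 pre).1) = _
    rw [GCtx.stepF_eq, growthRunF_eq P j G k]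
    rfl

/-- **FAST v1 GROWTH CHUNK CHECK** (`= growthRange`). [folklore] -/
def growthRangeF (P : ℕ → CoreOut → Bool) (j L q : ℕ) : Bool :=
  TV.growthRunF kitOf wT P j (TV.gctx j L q) (min L (TV.S j - q * L)) (q * L) ((TV.ctxOfW kitOf wT j).startNode (q * L)) #[]

/-- `growthRangeF = growthRange`. [folklore] -/
theorem growthRangeF_eq (P : ℕ → CoreOut → Bool) (j L q : ℕ) :
    TV.growthRangeF kitOf wT P j L q = TV.growthRange kitOf wT P j L q := by
  unfold growthRangeF growthRange
  exact growthRunF_eq TV kitOf wT P j _ _ _ _ _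

/-- **FAST twin of the two-level chunk run `growthRun2`** (variant B; `step2F` in place of `step2`). [folklore] -/
def growthRun2F (P : ℕ → CoreOut → Bool) (j ℓ : ℕ) (G : GCtx) : ℕ → ℕ → NodeSt → GState2 → Bool
  | 0, s, _, st => G.claims2 s st
  | k + 1, s, N, st =>
    let o := (TV.ctxOfW kitOf wT j).subStep s N
    let r := G.step2F ℓ s o.core.M o.core.L1 st
    let st' := if (s + 1) % ℓ = 0 then G.bdry2 ℓ s r.1 else r.1
    ((o.ok && P s o.core) && r.2) && growthRun2F P j ℓ G k (s + 1) o.next st'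

/-- `growthRun2F = growthRun2`. [folklore] -/
theorem growthRun2F_eq (P : ℕ → CoreOut → Bool) (j ℓ : ℕ) (G : GCtx) :
    ∀ (k s : ℕ) (N : NodeSt) (st : GState2),
      TV.growthRun2F kitOf wT P j ℓ G k s N st = TV.growthRun2 kitOf wT P j ℓ G k s N st
  | 0, _, _, _ => rfl
  | k + 1, s, N, st => by
    show (((((TV.ctxOfW kitOf wT j).subStep s N).ok && P s ((TV.ctxOfW kitOf wT j).subStep s N).core) &&
        (G.step2F ℓ s ((TV.ctxOfW kitOf wT j).subStep s N).core.M ((TV.ctxOfW kitOf wT j).subStep s N).core.L1 st).2) &&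
        TV.growthRun2F kitOf wT P j ℓ G k (s + 1) ((TV.ctxOfW kitOf wT j).subStep s N).next
          (if (s + 1) % ℓ = 0 then
            G.bdry2 ℓ s (G.step2F ℓ s ((TV.ctxOfW kitOf wT j).subStep s N).core.M ((TV.ctxOfW kitOf wT j).subStep s N).core.L1 st).1
          else (G.step2F ℓ s ((TV.ctxOfW kitOf wT j).subStep s N).core.M ((TV.ctxOfW kitOf wT j).subStep s N).core.L1 st).1)) = _
    rw [GCtx.step2F_eq, growthRun2F_eq P j ℓ G k]
    rfl

/-- **FAST TWO-LEVEL GROWTH CHUNK CHECK** (`= growthRange2`). [folklore] -/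
def growthRange2F (P : ℕ → CoreOut → Bool) (j L ℓ q : ℕ) : Bool :=
  TV.growthRun2F kitOf wT P j ℓ (TV.gctx j L q) (min L (TV.S j - q * L)) (q * L) ((TV.ctxOfW kitOf wT j).startNode (q * L))
    { pre := #[], Uin := #[], Uout := (TV.gctx j L q).W, Pch := idIM TV.base.n }

/-- `growthRange2F = growthRange2`. [folklore] -/
theorem growthRange2F_eq (P : ℕ → CoreOut → Bool) (j L ℓ q : ℕ) :
    TV.growthRange2F kitOf wT P j L ℓ q = TV.growthRange2 kitOf wT P j L ℓ q := by
  unfold growthRange2F growthRange2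
  exact growthRun2F_eq TV kitOf wT P j ℓ _ _ _ _ _

end CertTablesV

end Summit.NavierStokesRegularity.NavierStokesRegularity.Theorems.TaylorModelCert
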